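import Literature.Probability.Percolation.AdjCover
import Literature.Probability.Percolation.AdjPairBuild
import Literature.Probability.Percolation.AdjOrderCert
import Literature.Probability.Percolation.TrapTipGuards
import Literature.Probability.Percolation.AdjExitGaps
import Literature.Probability.Percolation.OneArmLSW
import HarnessLib

/-!
# Packaging four exits into `OutMidExits4`

Topic `Literature/Probability/Percolation`; family `crit-perc` / near-critical percolation on `𝕋`.
A brick of the near-critical arm-separation theorem for four arms in the ADJACENT colour
arrangement (P. Nolin, EJP 13 (2008), Thm. 11, `j = 4`, `σ = BBWW` [arXiv 0711.4948: Thm. 10],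
§4.4): bookkeeping between the surgery (which delivers the exits of the two colours separately,
`colour_exits`, and the order certificate on the keys, `not_hexSep_keys`) and the covering lemma
(`OutMidExits4`, indexed by `Fin 4` in the anticlockwise order open, open, closed, closed). An exit
with its route and clauses is an `ExitDatum`; the pair clauses are `SameOK` / `CrossOK`; four data in
the right order with the pair clauses and the cyclic chain of keys give a member of `OutMidExits4`
(`mk_outMidExits4`); and from the unordered certificate `¬ HexSep` one of the four orders works
(`mem_outMidExits4_of_not_hexSep`).

Everything here is proved; no named facts are introduced.

## References

* P. Nolin, Near-critical percolation in two dimensions, *Electron. J. Probab.* 13 (2008), §4.1,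
  §4.4 (arXiv 0711.4948: §4.1; proof of Thm. 10) [Nolin2008].
-/

noncomputable section

open Set

namespace Literature.Probability.Percolation

open LatticeModels Lanes AdjTipData

/-- **An exit with its route and its clauses** (colour `b`). [cite: Nolin2008, §4.2 Def. 6–8, §4.4 (arXiv 0711.4948: Def. 6–8, Lemma 14)] -/
structure ExitDatum (P : OParams) (ω : SiteConfig (Site 2)) (b : Bool) where
  /-- the side -/
  i : ℕ
  hi : i < 6
  /-- the kind: fence from above? -/
  up : Bool
  /-- the actual tip row -/
  t : ℤ
  /-- the exit -/
  F : TrapExit P.M P.n P.k₀ P.K (rotConfig i (colCfg b ω))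
  /-- the route -/
  S : Set (Site 2)
  hz : F.z 1 = (if up then t - 3 * (F.k : ℤ) else t)
  hmid : -(2 * (P.M : ℤ)) + P.R₀ + 3 * F.k ≤ t ∧ t ≤ -(P.R₀ : ℤ)
  hP : PathIn triGraph S F.a F.m
  hS : S ⊆ (triAnnSet P.n (2 * P.M) ∪ trapExitZone P.M F.z F.k) ∩ rotConfig i (colCfg b ω)
  ht : ∀ v ∈ S, 2 * (P.M : ℤ) < triNorm v → ExitTight F.z F.k v
  /-- the actual start of the route, on `∂Λ_n` -/
  x : Site 2
  hx : triNorm x = P.n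
  hax : triRotIsoPow i F.a = x
  /-- the route meets `∂Λ_n` only at its start -/
  hin : ∀ v ∈ S, triNorm v = P.n → v = F.a
  /-- the tip is protected -/
  hprot : TipProt P.M up t F.k (rotConfig i (colCfg b ω))

namespace ExitDatum

variable {P : OParams} {ω : SiteConfig (Site 2)} {b b' : Bool}

/-- The key of the tip. [folklore] -/
def key (E : ExitDatum P ω b) : ℤ := rotKey P.M E.i E.t

/-- The actual structure: route and corner box. [folklore] -/
def struct (E : ExitDatum P ω b) : Set (Site 2) :=
  triRotIsoPow E.i '' (E.S ∪ triStrip (E.F.z 0 + E.F.k) (E.F.z 1 + E.F.k) E.F.k E.F.k)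

/-- **The same-colour pair clause** (directed). [folklore] -/
def SameOK (E E' : ExitDatum P ω b) : Prop :=
  Disjoint E.struct E'.struct ∧ (E.i = E'.i → E.t ≠ E'.t ∧ E.up = false ∧ (E.t < E'.t → E.t + 17 * E.F.k < E'.t))

/-- **The cross-colour pair clause** (directed). [folklore] -/
def CrossOK (E : ExitDatum P ω b) (E' : ExitDatum P ω b') : Prop :=
  E.i = E'.i → E.t ≠ E'.t ∧ (((E.up = false ∧ E.t < E'.t) ∨ (E.up = true ∧ E'.t < E.t)) → E.t + 8 * E.F.k < E'.t ∨ E'.t + 8 * E.F.k < E.t)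

end ExitDatum

open ExitDatum

/-- **Four exit data in the anticlockwise order give a member of `OutMidExits4`.** [cite: Nolin2008, §4.4 (arXiv 0711.4948: proof of Thm. 10, p. 12), σ = BBWW] -/
theorem mk_outMidExits4 {P : OParams} {ω : SiteConfig (Site 2)} (E0 E1 : ExitDatum P ω true) (E2 E3 : ExitDatum P ω false)
    (h01 : SameOK E0 E1) (h10 : SameOK E1 E0) (h23 : SameOK E2 E3) (h32 : SameOK E3 E2)
    (c02 : CrossOK E0 E2) (c03 : CrossOK E0 E3) (c12 : CrossOK E1 E2) (c13 : CrossOK E1 E3)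
    (c20 : CrossOK E2 E0) (c21 : CrossOK E2 E1) (c30 : CrossOK E3 E0) (c31 : CrossOK E3 E1)
    (hchain : cyc (12 * P.M) E0.key E1.key < cyc (12 * P.M) E0.key E2.key ∧ cyc (12 * P.M) E0.key E2.key < cyc (12 * P.M) E0.key E3.key) :
    ω ∈ OutMidExits4 P := by
  refine ⟨![E0.i, E1.i, E2.i, E3.i], ![E0.up, E1.up, E2.up, E3.up], ![E0.t, E1.t, E2.t, E3.t],
    Fin.cons E0.F (Fin.cons E1.F (Fin.cons E2.F (Fin.cons E3.F finZeroElim))), ![E0.S, E1.S, E2.S, E3.S],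
    ?_, ?_, ?_, ?_, ?_, ?_, ?_, ?_, ?_, ?_, hchain⟩
  · intro a; fin_cases a <;> [exact E0.hi; exact E1.hi; exact E2.hi; exact E3.hi]
  · intro a; fin_cases a <;> [exact E0.hz; exact E1.hz; exact E2.hz; exact E3.hz]
  · intro a; fin_cases a <;> [exact E0.hmid; exact E1.hmid; exact E2.hmid; exact E3.hmid]
  · intro a; fin_cases a <;> [exact E0.hP; exact E1.hP; exact E2.hP; exact E3.hP]
  · intro a; fin_cases a <;> [exact E0.hS; exact E1.hS; exact E2.hS; exact E3.hS]
  · intro a; fin_cases a <;> [exact E0.ht; exact E1.ht; exact E2.ht; exact E3.ht]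
  · intro a c hac hcol
    fin_cases a <;> fin_cases c <;> first | exact absurd rfl hac | exact absurd hcol (by decide) | skip
    · exact h01.1
    · exact h10.1
    · exact h23.1
    · exact h32.1
  · intro a c hac hi
    fin_cases a <;> fin_cases c <;> first | exact absurd rfl hac | skip
    · exact (h01.2 hi).1
    · exact (c02 hi).1
    · exact (c03 hi).1
    · exact (h10.2 hi).1
    · exact (c12 hi).1
    · exact (c13 hi).1
    · exact (c20 hi).1
    · exact (c21 hi).1
    · exact (h23.2 hi).1
    · exact (c30 hi).1
    · exact (c31 hi).1
    · exact (h32.2 hi).1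
  · intro a c hac hcol hi
    fin_cases a <;> fin_cases c <;> first | exact absurd rfl hac | exact absurd hcol (by decide) | skip
    · exact (h01.2 hi).2
    · exact (h10.2 hi).2
    · exact (h23.2 hi).2
    · exact (h32.2 hi).2
  · intro a c hcol hi
    fin_cases a <;> fin_cases c <;> first | exact absurd rfl hcol | skip
    · exact (c02 hi).2
    · exact (c03 hi).2
    · exact (c12 hi).2
    · exact (c13 hi).2
    · exact (c20 hi).2
    · exact (c21 hi).2
    · exact (c30 hi).2
    · exact (c31 hi).2

/-- `1 ≤ R₀` for valid parameters. [folklore] -/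
theorem OParams.ValidA.one_le_R₀ {P : OParams} (hV : P.ValidA) : 1 ≤ P.R₀ := by
  obtain ⟨-, hk₀, hμ, -, -, -, -, -, -, -, -, -, -, -, -, -, -, -, -, -, hR₀, -, -⟩ := hV.toValid.ifacts
  have := one_le_trapScale (k₀ := P.k₀) (by omega) 0
  have h2 := P.scale_le (j := 0) (by have := hV.toValid.hK; omega)
  omega

/-- Keys lie in `[0, 12M)`. [folklore] -/
theorem ExitDatum.key_range {P : OParams} (hV : P.ValidA) {ω : SiteConfig (Site 2)} {b : Bool} (E : ExitDatum P ω b) :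
    0 ≤ E.key ∧ E.key < 12 * P.M := by
  have hR₀ := hV.one_le_R₀
  have h := E.hmid
  have hk : (0 : ℤ) ≤ E.F.k := by positivity
  exact rotKey_range E.hi ⟨by omega, by omega⟩

/-- Keys of exits on different sides differ; on a common side the pair clauses make them differ. [folklore] -/
theorem ExitDatum.key_ne_of {P : OParams} (hV : P.ValidA) {ω : SiteConfig (Site 2)} {b b' : Bool} (E : ExitDatum P ω b) (E' : ExitDatum P ω b')
    (h : E.i = E'.i → E.t ≠ E'.t) : E.key ≠ E'.key := by
  have hR₀ : (1 : ℤ) ≤ P.R₀ := by exact_mod_cast hV.one_le_R₀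
  intro he
  unfold ExitDatum.key rotKey at he
  have h1 := E.hmid; have h2 := E'.hmid
  have hk1 : (0 : ℤ) ≤ E.F.k := by positivity
  have hk2 : (0 : ℤ) ≤ E'.F.k := by positivity
  have hM : (0 : ℤ) ≤ 2 * P.M := by positivity
  have hi : E.i = E'.i := by
    rcases lt_trichotomy E.i E'.i with hl | hl | hl
    · have : (E.i : ℤ) + 1 ≤ E'.i := by exact_mod_cast hl
      have := mul_le_mul_of_nonneg_left this hM
      linarith
    · exact hl
    · have : (E'.i : ℤ) + 1 ≤ E.i := by exact_mod_cast hl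
      have := mul_le_mul_of_nonneg_left this hM
      linarith
  have := h hi
  rw [hi] at he
  exact this (by linarith)

/-- **From the unordered certificate to `OutMidExits4`**: two open and two closed exit data with
all pair clauses and `¬ HexSep` of the closed keys against the open keys. [cite: Nolin2008, §4.1, §4.4 (arXiv 0711.4948: §4.1, σ up to cyclic permutation; proof of Thm. 10, p. 12), σ = BBWW] -/
theorem mem_outMidExits4_of_not_hexSep {P : OParams} (hV : P.ValidA) {ω : SiteConfig (Site 2)}
    (E0 E1 : ExitDatum P ω true) (E2 E3 : ExitDatum P ω false)
    (h01 : SameOK E0 E1) (h10 : SameOK E1 E0) (h23 : SameOK E2 E3) (h32 : SameOK E3 E2)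
    (c02 : CrossOK E0 E2) (c03 : CrossOK E0 E3) (c12 : CrossOK E1 E2) (c13 : CrossOK E1 E3)
    (c20 : CrossOK E2 E0) (c21 : CrossOK E2 E1) (c30 : CrossOK E3 E0) (c31 : CrossOK E3 E1)
    (hsep : ¬ HexSep E2.key E3.key E0.key E1.key) : ω ∈ OutMidExits4 P := by
  have n01 := E0.key_ne_of hV E1 fun h => (h01.2 h).1
  have n02 := E0.key_ne_of hV E2 fun h => (c02 h).1
  have n03 := E0.key_ne_of hV E3 fun h => (c03 h).1
  have n12 := E1.key_ne_of hV E2 fun h => (c12 h).1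
  have n13 := E1.key_ne_of hV E3 fun h => (c13 h).1
  have n23 := E2.key_ne_of hV E3 fun h => (h23.2 h).1
  obtain ⟨o, o', c, c', hoo, hcc, hch1, hch2⟩ := exists_chain_of_not_hexSep (N := 12 * P.M) (E0.key_range hV) (E1.key_range hV)
    (E2.key_range hV) (E3.key_range hV) n01 n02 n03 n12 n13 n23 hsep
  rcases Set.pair_eq_pair_iff.1 hoo with ⟨rfl, rfl⟩ | ⟨rfl, rfl⟩ <;> rcases Set.pair_eq_pair_iff.1 hcc with ⟨rfl, rfl⟩ | ⟨rfl, rfl⟩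
  · exact mk_outMidExits4 E0 E1 E2 E3 h01 h10 h23 h32 c02 c03 c12 c13 c20 c21 c30 c31 ⟨hch1, hch2⟩
  · exact mk_outMidExits4 E0 E1 E3 E2 h01 h10 h32 h23 c03 c02 c13 c12 c30 c31 c20 c21 ⟨hch1, hch2⟩
  · exact mk_outMidExits4 E1 E0 E2 E3 h10 h01 h23 h32 c12 c13 c02 c03 c21 c20 c31 c30 ⟨hch1, hch2⟩
  · exact mk_outMidExits4 E1 E0 E3 E2 h10 h01 h32 h23 c13 c12 c03 c02 c31 c30 c21 c20 ⟨hch1, hch2⟩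

/-! ### From the arms and the good events to `OutMidExits4` -/

/-- **The good event around `∂Λ_{2M}`** for the adjacent landing: behind each of the six sides and for
both colours, the explorations are short and good with middle term tips and a midpoint guard
(`FrameGood`), and the two corners of the side are guarded (`InGuard`, base radius `R_g`). [cite: Nolin2008, §4.4 Lemma 15 and Thm. 11 (proof) (arXiv 0711.4948: Lemma 14, Thm. 10)] -/
def AdjGood (P : OParams) (T T' Rg Kg : ℕ) (ω : SiteConfig (Site 2)) : Prop :=
  ∀ f < 6, ∀ b : Bool, FrameGood P.M P.k₀ P.K T T' (rotConfig f (colCfg b ω)) ∧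
    InGuard Rg Kg (extC₁ P.M) (rotConfig f (colCfg b ω)) ∧ InGuard Rg Kg (extC₂ P.M) (rotConfig f (colCfg b ω))

/-- Corner guards give closed frames of scales `≥ R_g`, `≤ (M-1)/2`. [folklore] -/
theorem frames_of_inGuard {M Rg Kg : ℕ} (hRgM : ∀ l < Kg, 2 * trapScale Rg l + 1 ≤ M) {χ : SiteConfig (Site 2)}
    (h₁ : InGuard Rg Kg (extC₁ M) χ) (h₂ : InGuard Rg Kg (extC₂ M) χ) :
    ∃ R₁ R₂, Rg ≤ R₁ ∧ 2 * R₁ + 1 ≤ M ∧ Rg ≤ R₂ ∧ 2 * R₂ + 1 ≤ M ∧ χᶜ ∈ triFrameAt (extC₁ M) R₁ ∧ χᶜ ∈ triFrameAt (extC₂ M) R₂ := by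
  obtain ⟨l₁, hl₁, hg₁⟩ := h₁
  obtain ⟨l₂, hl₂, hg₂⟩ := h₂
  exact ⟨_, _, le_trapScale Rg l₁, hRgM l₁ hl₁, le_trapScale Rg l₂, hRgM l₂ hl₂, hg₁.1, hg₂.1⟩

/-- **A protected tip is in the middle under the corner guards**: `-2M + R₁ ≤ t ≤ -R₂`. [cite: Nolin2008, §4.4 Thm. 11 (proof) (arXiv 0711.4948: Thm. 10)] -/
theorem tip_mid_of_tipProt {M R₁ R₂ : ℕ} (h₁ : 1 ≤ R₁) (h₁M : 2 * R₁ + 1 ≤ M) (h₂ : 1 ≤ R₂) (h₂M : 2 * R₂ + 1 ≤ M)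
    {χ : SiteConfig (Site 2)} (hdn : χᶜ ∈ triFrameAt (extC₁ M) R₁) (hup : χᶜ ∈ triFrameAt (extC₂ M) R₂)
    {up : Bool} {t : ℤ} {k : ℕ} (hprot : TipProt M up t k χ) : -(2 * (M : ℤ)) + R₁ ≤ t ∧ t ≤ -(R₂ : ℤ) := by
  obtain ⟨c, z, rfl, hz, hcχ, hb, hu⟩ := hprot
  have hc : (trapDomain M).IsCrossing c z := by
    cases up
    · exact (hb rfl).1
    · exact (JDomain.flip_isCrossing_iff _).1 (hu rfl).1
  obtain ⟨f, hfc, hfI⟩ := hc.exists_start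
  have hf0 := (mem_trapI.1 hfI).2
  refine tip_bounds_of_guards' h₁ h₂ hdn hup (A := (↑c : Set (Site 2))) (a := f) (by omega) (by omega) hc.tip_mem_J ?_
  exact (hc.conn f hfc z hc.tip_mem).mono fun v hv => ⟨hv, hcχ hv⟩

/-- The tip of a protected exit is a site of the configuration (open below-tips) resp. its
crossing is: the tip lies in the crossing, which is `χ`-open. [folklore] -/
theorem tip_open_of_tipProt {M : ℕ} {χ : SiteConfig (Site 2)} {up : Bool} {t : ℤ} {k : ℕ} (hprot : TipProt M up t k χ) :
    (![2 * (M : ℤ), t] : Site 2) ∈ χ := by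
  obtain ⟨c, z, rfl, hz, hcχ, hb, hu⟩ := hprot
  have hc : (trapDomain M).IsCrossing c z := by
    cases up
    · exact (hb rfl).1
    · exact (JDomain.flip_isCrossing_iff _).1 (hu rfl).1
  have hz0 := (mem_trapO.1 hz).2
  have e : (![2 * (M : ℤ), z 1] : Site 2) = z := LatticeModels.Mesh.site2_ext' (by rw [hz0]; rfl) rfl
  rw [e]; exact hcχ hc.tip_mem

/-- Reading a configuration in the other colour through the same rotation complements it. [folklore] -/
theorem rotConfig_colCfg_not (i : ℕ) (b : Bool) (ω : SiteConfig (Site 2)) : rotConfig i (colCfg (!b) ω) = (rotConfig i (colCfg b ω))ᶜ := by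
  ext v; simp only [mem_rotConfig, colCfg, Set.mem_setOf_eq, Set.mem_compl_iff]; cases b <;> simp

/-- **The gap between tips of different colours on a common side** from the protections. [cite: Nolin2008, §4.4 Lemma 15 (proof) (arXiv 0711.4948: Lemma 14)] -/
theorem cross_gap_of_tipProt {M : ℕ} {χ : SiteConfig (Site 2)} {up up' : Bool} {t t' : ℤ} {k k' : ℕ} (hk : 1 ≤ k) (hkM : 16 * k + 1 ≤ M)
    (hprot : TipProt M up t k χ) (hprot' : TipProt M up' t' k' χᶜ) :
    t ≠ t' ∧ (((up = false ∧ t < t') ∨ (up = true ∧ t' < t)) → t + 8 * k < t' ∨ t' + 8 * k < t) := by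
  have hop := tip_open_of_tipProt hprot
  have hcl := tip_open_of_tipProt hprot'
  refine ⟨fun e => hcl (by rw [← e]; exact hop), ?_⟩
  obtain ⟨c, z, rfl, hz, hcχ, hb, hu⟩ := hprot
  obtain ⟨c', z', rfl, hz', hc'χ, hb', hu'⟩ := hprot'
  have hc' : (trapDomain M).IsCrossing c' z' := by
    cases up'
    · exact (hb' rfl).1
    · exact (JDomain.flip_isCrossing_iff _).1 (hu' rfl).1
  rintro (⟨hupf, hlt⟩ | ⟨hupt, hlt⟩)
  · obtain ⟨hc, hraw⟩ := hb hupf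
    exact Or.inl (tip_gap_above hraw hk hkM hc hcχ hc' hc'χ hlt)
  · obtain ⟨hd, hraw⟩ := hu hupt
    exact Or.inr (tip_gap_below hraw hk hkM hd hcχ hc' hc'χ hlt)

/-! ### The order certificate from the data -/

namespace ExitDatum

variable {P : OParams} {ω : SiteConfig (Site 2)} {b : Bool}

/-- The actual route. [folklore] -/
def route (E : ExitDatum P ω b) : Set (Site 2) := triRotIsoPow E.i '' E.S

/-- `32 k ≤ μ` for the scale of the exit. [folklore] -/
theorem scale_le (E : ExitDatum P ω b) : 32 * E.F.k ≤ P.μ := P.scale_le E.F.j_lt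

/-- The actual route is a path from the actual start to the actual fence site. [folklore] -/
theorem pathIn_route (E : ExitDatum P ω b) : PathIn triGraph E.route E.x (triRotIsoPow E.i E.F.m) := by
  have h := pathIn_map_iso (triRotIsoPow E.i) E.hP
  rw [E.hax] at h; exact h

/-- The actual fence site lies beyond `∂Λ_{2M}`. [folklore] -/
theorem norm_m (hV : P.ValidA) (E : ExitDatum P ω b) : 2 * (P.M : ℤ) < triNorm (triRotIsoPow E.i E.F.m) := by
  obtain ⟨b', t', -, -, hp, -⟩ := E.F.vcross
  have hm := (mem_triStrip.1 hp.right_mem.1)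
  have hz := (mem_trapO.1 E.F.z_mem).2
  have hk : 1 ≤ trapScale P.k₀ E.F.j := one_le_trapScale (by have := hV.toValid.hk₀; omega) _
  have hk' : 1 ≤ E.F.k := hk
  rw [triNorm_triRotIsoPow]
  have h0 : 2 * (P.M : ℤ) < E.F.m 0 := by omega
  exact lt_of_lt_of_le h0 (le_triNorm_iff_lin.2 (Or.inl le_rfl))

/-- Route sites have norm `≥ n`. [folklore] -/
theorem norm_route (hV : P.ValidA) (E : ExitDatum P ω b) : ∀ v ∈ E.route, (P.n : ℤ) ≤ triNorm v := by
  rintro v ⟨u, hu, rfl⟩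
  rw [triNorm_triRotIsoPow]
  have hnM := hV.toValid.hn
  rcases (E.hS hu).1 with h | h
  · exact (mem_triAnnSet.1 h).1
  · rcases (mem_trapExitZone.1 h).1 with h' | h'
    · have := (mem_trapD.1 h').1
      have := le_triNorm_iff_lin.2 (Or.inl (le_refl (u 0))); omega
    · omega

/-- The route meets `∂Λ_n` only at the actual start. [folklore] -/
theorem route_clean (E : ExitDatum P ω b) : ∀ v ∈ E.route, triNorm v = P.n → v = E.x := by
  rintro v ⟨u, hu, rfl⟩ hvn
  rw [triNorm_triRotIsoPow] at hvn
  rw [E.hin u hu hvn, E.hax]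

/-- Route sites are of the colour `b`. [folklore] -/
theorem route_colour (E : ExitDatum P ω b) : ∀ v ∈ E.route, (v ∈ ω ↔ b) := by
  rintro v ⟨u, hu, rfl⟩
  have h := (E.hS hu).2
  rw [mem_rotConfig] at h
  exact h

/-- **Tightness in the form of the order certificate**: a route site beyond `∂Λ_{2M}` reads, in the
frame, beyond the side in the rows `(ζ, ζ + 3k)`. [folklore] -/
theorem route_tight (hV : P.ValidA) (E : ExitDatum P ω b) : ∀ v ∈ E.route, 2 * (P.M : ℤ) < triNorm v →
    ∃ u, triRotIsoPow E.i u = v ∧ 2 * (P.M : ℤ) < u 0 ∧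
      (if E.up then E.t - 3 * (E.F.k : ℤ) else E.t) < u 1 ∧ u 1 < (if E.up then E.t - 3 * (E.F.k : ℤ) else E.t) + 3 * E.F.k := by
  rintro v ⟨u, hu, rfl⟩ hvn
  rw [triNorm_triRotIsoPow] at hvn
  obtain ⟨h1, h2, h3, h4⟩ := E.ht u hu hvn
  rw [E.hz] at h1 h2
  refine ⟨u, rfl, ?_, h1, h2⟩
  -- `|u| > 2M` with a middle row forces `u₀ > 2M`
  have hmid := E.hmid
  have hR₀ := hV.toValid.hR₀
  have hsc := E.scale_le
  have hz := (mem_trapO.1 E.F.z_mem).2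
  by_contra h0; push Not at h0
  have : triNorm u ≤ 2 * (P.M : ℤ) := triNorm_le_iff_lin.2 (by split_ifs at h1 h2 <;> omega)
  omega

/-- `8k`-middle tips from the `R₀`-middle clause (`R₀ ≥ 8μ ≥ 256 k`). [folklore] -/
theorem tip_mid8 (hV : P.ValidA) (E : ExitDatum P ω b) : -(2 * (P.M : ℤ)) + 8 * E.F.k < E.t ∧ E.t + 8 * E.F.k < 0 := by
  have hmid := E.hmid; have hR₀ := hV.toValid.hR₀; have hsc := E.scale_le
  have hk : 1 ≤ E.F.k := one_le_trapScale (by have := hV.toValid.hk₀; omega) _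
  constructor <;> omega

end ExitDatum

/-- **The order certificate from the data**: four exit data (open `E0, E1`, closed `E2, E3`) with the
pair clauses and the inner certificate on the actual starts give `¬ HexSep` of the keys. [cite: Nolin2008, §4.1, §4.4 (arXiv 0711.4948: §4.1; proof of Thm. 10)] -/
theorem not_hexSep_keys_of_data {P : OParams} (hV : P.ValidA) (hn1 : 1 ≤ P.n) {ω : SiteConfig (Site 2)}
    (E0 E1 : ExitDatum P ω true) (E2 E3 : ExitDatum P ω false)
    (h01 : SameOK E0 E1) (h10 : SameOK E1 E0) (h23 : SameOK E2 E3) (h32 : SameOK E3 E2)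
    (c02 : CrossOK E0 E2) (c03 : CrossOK E0 E3) (c12 : CrossOK E1 E2) (c13 : CrossOK E1 E3)
    (c20 : CrossOK E2 E0) (c21 : CrossOK E2 E1) (c30 : CrossOK E3 E0) (c31 : CrossOK E3 E1)
    (hsep : ¬ HexSep (hexPos P.n E2.x) (hexPos P.n E3.x) (hexPos P.n E0.x) (hexPos P.n E1.x)) :
    ¬ HexSep E2.key E3.key E0.key E1.key := by
  have hnM := hV.toValid.hn
  have hM : 1 ≤ P.M := le_trans hn1 hnM
  have hk : ∀ {b : Bool} (E : ExitDatum P ω b), 1 ≤ E.F.k := fun E => one_le_trapScale (by have := hV.toValid.hk₀; omega) _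
  -- same-colour routes are disjoint by the structures, cross-colour routes by the colours
  have dS : ∀ {b : Bool} {E E' : ExitDatum P ω b}, SameOK E E' → Disjoint E.route E'.route := fun h =>
    Set.disjoint_of_subset (Set.image_mono Set.subset_union_left) (Set.image_mono Set.subset_union_left) h.1
  have dC : ∀ {E : ExitDatum P ω true} {E' : ExitDatum P ω false}, Disjoint E.route E'.route := fun {E E'} =>
    Set.disjoint_left.2 fun v hv hv' => by
      have h1 := (E.route_colour v hv); have h2 := (E'.route_colour v hv')
      simp only [iff_true, Bool.false_eq_true, iff_false] at h1 h2; exact h2 h1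
  refine not_hexSep_keys (n := P.n) (M := P.M) hn1 (by omega) (col := ![true, true, false, false]) rfl
    (i := ![E0.i, E1.i, E2.i, E3.i]) (up := ![E0.up, E1.up, E2.up, E3.up]) (t := ![E0.t, E1.t, E2.t, E3.t])
    (k := ![E0.F.k, E1.F.k, E2.F.k, E3.F.k]) (x := ![E0.x, E1.x, E2.x, E3.x])
    (m := ![triRotIsoPow E0.i E0.F.m, triRotIsoPow E1.i E1.F.m, triRotIsoPow E2.i E2.F.m, triRotIsoPow E3.i E3.F.m])
    (R := ![E0.route, E1.route, E2.route, E3.route]) ?_ ?_ ?_ ?_ ?_ ?_ ?_ ?_ ?_ ?_ ?_ ?_ ?_ hsep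
  · intro a; fin_cases a <;> [exact E0.hi; exact E1.hi; exact E2.hi; exact E3.hi]
  · intro a; fin_cases a <;> [exact hk E0; exact hk E1; exact hk E2; exact hk E3]
  · intro a; fin_cases a <;> [exact E0.tip_mid8 hV; exact E1.tip_mid8 hV; exact E2.tip_mid8 hV; exact E3.tip_mid8 hV]
  · intro a; fin_cases a <;> [exact E0.hx; exact E1.hx; exact E2.hx; exact E3.hx]
  · intro a; fin_cases a <;> [exact E0.norm_m hV; exact E1.norm_m hV; exact E2.norm_m hV; exact E3.norm_m hV]
  · intro a; fin_cases a <;> [exact E0.pathIn_route; exact E1.pathIn_route; exact E2.pathIn_route; exact E3.pathIn_route]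
  · intro a; fin_cases a <;> [exact E0.norm_route hV; exact E1.norm_route hV; exact E2.norm_route hV; exact E3.norm_route hV]
  · intro a; fin_cases a <;> [exact E0.route_clean; exact E1.route_clean; exact E2.route_clean; exact E3.route_clean]
  · intro a; fin_cases a <;> [exact E0.route_tight hV; exact E1.route_tight hV; exact E2.route_tight hV; exact E3.route_tight hV]
  · intro a c hac
    fin_cases a <;> fin_cases c <;> first | exact absurd rfl hac | skip
    · exact dS h01
    · exact dC
    · exact dC
    · exact dS h10
    · exact dC
    · exact dC
    · exact dC.symm
    · exact dC.symm
    · exact dS h23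
    · exact dC.symm
    · exact dC.symm
    · exact dS h32
  · intro a c hac hi
    fin_cases a <;> fin_cases c <;> first | exact absurd rfl hac | skip
    · exact (h01.2 hi).1
    · exact (c02 hi).1
    · exact (c03 hi).1
    · exact (h10.2 hi).1
    · exact (c12 hi).1
    · exact (c13 hi).1
    · exact (c20 hi).1
    · exact (c21 hi).1
    · exact (h23.2 hi).1
    · exact (c30 hi).1
    · exact (c31 hi).1
    · exact (h32.2 hi).1
  · intro a c hac hcol hi
    fin_cases a <;> fin_cases c <;> first | exact absurd rfl hac | exact absurd hcol (by decide) | skip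
    · exact (h01.2 hi).2
    · exact (h10.2 hi).2
    · exact (h23.2 hi).2
    · exact (h32.2 hi).2
  · intro a c hcol hi
    fin_cases a <;> fin_cases c <;> first | exact absurd rfl hcol | skip
    · exact (c02 hi).2
    · exact (c03 hi).2
    · exact (c12 hi).2
    · exact (c13 hi).2
    · exact (c20 hi).2
    · exact (c21 hi).2
    · exact (c30 hi).2
    · exact (c31 hi).2

/-- **From the data and the inner certificate to `OutMidExits4`.** [cite: Nolin2008, §4.1, §4.4 (arXiv 0711.4948: §4.1; proof of Thm. 10, p. 12), σ = BBWW] -/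
theorem mem_outMidExits4_of_data {P : OParams} (hV : P.ValidA) (hn1 : 1 ≤ P.n) {ω : SiteConfig (Site 2)}
    (E0 E1 : ExitDatum P ω true) (E2 E3 : ExitDatum P ω false)
    (h01 : SameOK E0 E1) (h10 : SameOK E1 E0) (h23 : SameOK E2 E3) (h32 : SameOK E3 E2)
    (c02 : CrossOK E0 E2) (c03 : CrossOK E0 E3) (c12 : CrossOK E1 E2) (c13 : CrossOK E1 E3)
    (c20 : CrossOK E2 E0) (c21 : CrossOK E2 E1) (c30 : CrossOK E3 E0) (c31 : CrossOK E3 E1)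
    (hsep : ¬ HexSep (hexPos P.n E2.x) (hexPos P.n E3.x) (hexPos P.n E0.x) (hexPos P.n E1.x)) : ω ∈ OutMidExits4 P :=
  mem_outMidExits4_of_not_hexSep hV E0 E1 E2 E3 h01 h10 h23 h32 c02 c03 c12 c13 c20 c21 c30 c31
    (not_hexSep_keys_of_data hV hn1 E0 E1 E2 E3 h01 h10 h23 h32 c02 c03 c12 c13 c20 c21 c30 c31 hsep)

/-! ### The surgery -/

/-- Swapping within a pair keeps non-separation. [folklore] -/
theorem not_hexSep_comm_left {a b c d : ℤ} (h : ¬ HexSep a b c d) : ¬ HexSep b a c d := fun h' => h (hexSep_comm_left h')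

/-- Swapping within a pair keeps non-separation. [folklore] -/
theorem not_hexSep_comm_right {a b c d : ℤ} (h : ¬ HexSep a b c d) : ¬ HexSep a b d c := fun h' => h (hexSep_comm_right h')

/-- **The middle clause of an exit delivered by `colour_exits`** under the corner guards. [folklore] -/
theorem exit_hmid {P : OParams} (hV : P.ValidA) {T T' Rg Kg : ℕ} (hRg : P.R₀ + P.μ ≤ Rg)
    (hRgM : ∀ l < Kg, 2 * trapScale Rg l + 1 ≤ P.M) {ω : SiteConfig (Site 2)} (hg : AdjGood P T T' Rg Kg ω)
    {b : Bool} {fr : ℕ} (hfr : fr < 6) (F : TrapExit P.M P.n P.k₀ P.K (rotConfig fr (colCfg b ω))) {up : Bool} {tt : ℤ}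
    (hprot : TipProt P.M up tt F.k (rotConfig fr (colCfg b ω))) :
    -(2 * (P.M : ℤ)) + P.R₀ + 3 * F.k ≤ tt ∧ tt ≤ -(P.R₀ : ℤ) := by
  obtain ⟨R₁, R₂, hR₁, hR₁M, hR₂, hR₂M, hdn, hup⟩ := frames_of_inGuard hRgM (hg fr hfr b).2.1 (hg fr hfr b).2.2
  have hR₀ := hV.toValid.hR₀
  have hμ : 32 * F.k ≤ P.μ := P.scale_le F.j_lt
  have hk : 1 ≤ F.k := one_le_trapScale (by have := hV.toValid.hk₀; omega) _
  have hbd := tip_mid_of_tipProt (by omega) hR₁M (by omega) hR₂M hdn hup hprot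
  constructor <;> omega

/-- Undoing the frame reading of the start. [folklore] -/
theorem exit_hax {fr : ℕ} (hfr : fr < 6) {a x₀ : Site 2} (ha : a = triRotIsoPow (6 - fr) x₀) : triRotIsoPow fr a = x₀ := by
  rw [ha, ← triRotIsoPow_add_apply, show 6 - fr + fr = 6 by omega, triRotIsoPow_six_apply]

/-- Two distinct indices of `Fin 2`. [folklore] -/
theorem fin2_cases_of_ne {a b : Fin 2} (h : a ≠ b) : (a = 0 ∧ b = 1) ∨ (a = 1 ∧ b = 0) := by
  revert a b; decide

/-- **The surgery of the adjacent landing**: the arms of `adjFourArmCyc n (2M)` together with the good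
events around `∂Λ_{2M}` (`AdjGood`, corner guards of base radius `R_g ≥ R₀ + μ`) give a member of
`OutMidExits4 P`. [cite: Nolin2008, §4.1, §4.2 Def. 6–8, §4.4 Lemma 15 and Thm. 11 (proof) (arXiv 0711.4948: §4.1, Def. 6–8, Lemma 14, Thm. 10), σ = BBWW] -/
theorem adjFourArmCyc_subset_outMidExits4 {P : OParams} (hV : P.ValidA) (hn1 : 1 ≤ P.n) {T T' Rg Kg : ℕ}
    (hRg : P.R₀ + P.μ ≤ Rg) (hRgM : ∀ l < Kg, 2 * trapScale Rg l + 1 ≤ P.M) :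
    adjFourArmCyc P.n (2 * P.M) ∩ {ω | AdjGood P T T' Rg Kg ω} ⊆ OutMidExits4 P := by
  rintro ω ⟨harm, hg⟩
  have hnM := hV.toValid.hn; have hK := hV.toValid.hK; have hk₀ := hV.toValid.hk₀; have hμM := hV.toValid.hμM
  have hR₀ := hV.toValid.hR₀
  have hM : 1 ≤ P.M := le_trans hn1 hnM
  have hKM : ∀ j < P.K, 32 * trapScale P.k₀ j + 1 ≤ P.M := fun j hj => by have := P.scale_le hj; omega
  have hκ : 32 * trapScale P.k₀ (P.K - 1) ≤ P.μ := P.scale_le (by omega)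
  have hκ1 : 1 ≤ trapScale P.k₀ (P.K - 1) := one_le_trapScale (by omega) _
  have hk16 : ∀ {χ : SiteConfig (Site 2)} (F : TrapExit P.M P.n P.k₀ P.K χ), 1 ≤ F.k ∧ 16 * F.k + 1 ≤ P.M := fun F =>
    ⟨one_le_trapScale (by omega) _, by have := P.scale_le F.j_lt; change 16 * trapScale P.k₀ F.j + 1 ≤ P.M; omega⟩
  -- ### clean arms and the inner certificate
  obtain ⟨x, y, Wt, hW, hdW, hsep0⟩ := exists_clean_arms hn1 (by omega) harm
  have harms : ∀ j, ∃ w : triGraph.Walk (x j) (y j), w.IsPath ∧ ∀ v ∈ w.support, v ∈ Wt j := fun j => by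
    obtain ⟨w, hw⟩ := (hW j).2.2.2.1.exists_walk
    exact ⟨w.bypass, w.bypass_isPath, fun v hv => hw v (w.support_bypass_subset_support hv)⟩
  choose w hwp hwW using harms
  -- ### the ends: sides and rows
  have hends : ∀ j, ∃ fr : ℕ, fr < 6 ∧ ∃ tr : ℤ, -(2 * (P.M : ℤ)) ≤ tr ∧ tr < 0 ∧ y j = triRotIsoPow fr ![2 * (P.M : ℤ), tr] := fun j => by
    obtain ⟨fr, hfr, tr, htr, htr0, e⟩ := exists_rot_side0 (N := 2 * P.M) (by omega) (hW j).2.1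
    refine ⟨fr, hfr, tr, by exact_mod_cast htr, htr0, ?_⟩
    rw [e]; congr 1
  choose f hf t htlo hthi hyf using hends
  -- ### colours, middle ends
  have hcolour : ∀ j, ∀ v ∈ (w j).support, v ∈ colCfg ((![true, false, true, false] : Fin 4 → Bool) j) ω :=
    fun j v hv => (hW j).2.2.2.2.2.2 v (hwW j v hv)
  have hendmid : ∀ j, -(2 * (P.M : ℤ)) + Rg ≤ t j ∧ t j ≤ -(Rg : ℤ) := fun j => by
    obtain ⟨R₁, R₂, hR₁, hR₁M, hR₂, hR₂M, hdn, hup⟩ := frames_of_inGuard hRgM (hg (f j) (hf j) _).2.1 (hg (f j) (hf j) _).2.2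
    set A : Set (Site 2) := {v | v ∈ (frameWalk (f j) (w j)).support} with hA
    have hPw : PathIn triGraph (A ∩ rotConfig (f j) (colCfg ((![true, false, true, false] : Fin 4 → Bool) j) ω))
        (triRotIsoPow (6 - f j) (x j)) (triRotIsoPow (6 - f j) (y j)) :=
      PathIn.of_walk (frameWalk (f j) (w j)) fun v hv =>
        ⟨hv, (frameWalk_supp (hf j).le (fun v hv => by have := mem_triAnn.1 ((hW j).2.2.1 (hwW j v hv)); exact_mod_cast this)
          (hcolour j) v hv).2⟩
    rw [frame_end (hf j).le (hyf j)] at hPw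
    have ha0 : (triRotIsoPow (6 - f j) (x j)) 0 ≤ P.n := by
      have h := (hW j).1
      exact (triNorm_le_iff_lin.1 (le_of_eq (by rw [triNorm_rot]; exact h))).1
    have hbd := tip_bounds_of_guards' (by omega) (by omega) hdn hup (a := triRotIsoPow (6 - f j) (x j)) (by omega) (by omega)
      (side_point_mem_trapO hM ⟨htlo j, (hthi j).le⟩) hPw
    have e1 : (![2 * (P.M : ℤ), t j] : Site 2) 1 = t j := rfl
    rw [e1] at hbd
    constructor <;> omega
  -- ### the two exits of one colour, as data
  have hce : ∀ (b : Bool) (jj : Fin 2 → Fin 4), (∀ q, (![true, false, true, false] : Fin 4 → Bool) (jj q) = b) → jj 0 ≠ jj 1 →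
      ∃ E E' : ExitDatum P ω b, SameOK E E' ∧ SameOK E' E ∧ ({E.x, E'.x} : Set (Site 2)) = {x (jj 0), x (jj 1)} := by
    intro b jj hjb hjj
    obtain ⟨r, F, F', S, S', up, up', tt, tt', hr, haF, haF', hzF, hzF', -, -, hprot, hprot', hPF, hPF', hSF, hSF', htF, htF',
        hdj, hsame, hin, hin'⟩ :=
      colour_exits (M := P.M) (n := P.n) (k₀ := P.k₀) (K := P.K) (T := T) (T' := T') hn1 hnM (by omega) hK hKM
        (χ := colCfg b ω) (x := fun q => x (jj q)) (y := fun q => y (jj q)) (fun q => w (jj q)) (fun q => hwp _) (fun q => (hW _).1)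
        (fun q v hv => by have := mem_triAnn.1 ((hW _).2.2.1 (hwW _ v hv)); exact_mod_cast this)
        (fun q v hv => by rw [← hjb q]; exact hcolour _ v hv)
        (fun q v hv hvn => (hW _).2.2.2.2.2.1 v (hwW _ v hv) (by exact_mod_cast hvn))
        (fun q v hv hvn => (hW _).2.2.2.2.1 v (hwW _ v hv) hvn)
        (fun v hv hv' => Set.disjoint_left.1 (hdW hjj) (hwW _ v hv) (hwW _ v hv'))
        (i := fun q => f (jj q)) (t := fun q => t (jj q)) (fun q => hf _) (fun q => hyf _)
        (fun q => by have := hendmid (jj q); constructor <;> omega)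
        (fun q => (hg (f (jj q)) (hf _) b).1)
    let E : ExitDatum P ω b := ⟨f (jj 0), hf _, up, tt, F, S, hzF, exit_hmid hV hRg hRgM hg (hf _) F hprot, hPF, hSF, htF,
      x (jj (r 0)), (hW _).1, exit_hax (hf _) haF, hin, hprot⟩
    let E' : ExitDatum P ω b := ⟨f (jj 1), hf _, up', tt', F', S', hzF', exit_hmid hV hRg hRgM hg (hf _) F' hprot', hPF', hSF', htF',
      x (jj (r 1)), (hW _).1, exit_hax (hf _) haF', hin', hprot'⟩
    refine ⟨E, E', ⟨hdj, fun hi => ?_⟩, ⟨hdj.symm, fun hi => ?_⟩, ?_⟩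
    · obtain ⟨h1, -, h3, h4, -⟩ := hsame hi; exact ⟨h3, h1, h4⟩
    · obtain ⟨-, h2, h3, -, h5⟩ := hsame (Eq.symm hi); exact ⟨h3.symm, h2, h5⟩
    · show ({x (jj (r 0)), x (jj (r 1))} : Set (Site 2)) = {x (jj 0), x (jj 1)}
      rcases fin2_cases_of_ne hr with ⟨h0, h1⟩ | ⟨h0, h1⟩
      · rw [h0, h1]
      · rw [h0, h1, Set.pair_comm]
  obtain ⟨EO, EO', hOO, hOO', hxO⟩ := hce true ![0, 2] (fun q => by fin_cases q <;> rfl) (by decide)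
  obtain ⟨EC, EC', hCC, hCC', hxC⟩ := hce false ![1, 3] (fun q => by fin_cases q <;> rfl) (by decide)
  -- ### the cross-colour clauses
  have crossOC : ∀ (E : ExitDatum P ω true) (E' : ExitDatum P ω false), CrossOK E E' ∧ CrossOK E' E := by
    intro E E'
    constructor
    · intro hi
      have h' : TipProt P.M E'.up E'.t E'.F.k (rotConfig E.i (colCfg true ω))ᶜ := by
        rw [← rotConfig_colCfg_not, show (!true) = false from rfl, hi]; exact E'.hprot
      exact cross_gap_of_tipProt (hk16 E.F).1 (hk16 E.F).2 E.hprot h'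
    · intro hi
      have h' : TipProt P.M E.up E.t E.F.k (rotConfig E'.i (colCfg false ω))ᶜ := by
        rw [← rotConfig_colCfg_not, show (!false) = true from rfl, hi]; exact E.hprot
      exact cross_gap_of_tipProt (hk16 E'.F).1 (hk16 E'.F).2 E'.hprot h'
  -- ### the inner certificate for the data
  have hsep : ¬ HexSep (hexPos P.n EC.x) (hexPos P.n EC'.x) (hexPos P.n EO.x) (hexPos P.n EO'.x) := by
    have hxO' : ({EO.x, EO'.x} : Set (Site 2)) = {x 0, x 2} := hxO
    have hxC' : ({EC.x, EC'.x} : Set (Site 2)) = {x 1, x 3} := hxC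
    rcases Set.pair_eq_pair_iff.1 hxO' with ⟨e0, e1⟩ | ⟨e0, e1⟩ <;> rcases Set.pair_eq_pair_iff.1 hxC' with ⟨e2, e3⟩ | ⟨e2, e3⟩ <;>
      rw [e0, e1, e2, e3]
    · exact hsep0
    · exact not_hexSep_comm_left hsep0
    · exact not_hexSep_comm_right hsep0
    · exact not_hexSep_comm_right (not_hexSep_comm_left hsep0)
  exact mem_outMidExits4_of_data hV hn1 EO EO' EC EC' hOO hOO' hCC hCC'
    (crossOC EO EC).1 (crossOC EO EC').1 (crossOC EO' EC).1 (crossOC EO' EC').1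
    (crossOC EO EC).2 (crossOC EO' EC).2 (crossOC EO EC').2 (crossOC EO' EC').2 hsep

end Literature.Probability.Percolation
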